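import Mathlib
import HarnessLib

/-!
# The two-spacing scaling exponent when the SCALES are uncertain too: a worst-case error bar for errors in the abscissa, and the combined budget

HONEST FRAMING: exact (Metropolis-corrected) sampling algorithms for lattice gauge theory;
figures of merit are autocorrelation/cost numbers at stated couplings and volumes; no
continuum-physics claim.

Venture `LatticeQCDFlow` (cell pub-lqcd), topic `Scaling`, FANOUT row 21 (`su3-base`: deliverable "CSD exponent" — the growth of
`τ_int(Q²)` between the couplings `β ∈ {6.0, 6.2}` read as a two-spacing exponent `z = log(τ₂/τ₁) / log(x₂/x₁)`, `x = 1/a(β)`; the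
lattice spacings `a(β)` come from a published scale setting WITH ERROR BARS, so the abscissa `log(x₂/x₁)` is itself uncertain).
OUR WORK, elementary real analysis over Mathlib; companion of `Scaling/SecantExponentErrorBar.lean` (errors in the ORDINATES `τᵢ`);
nothing is cited as a fact; no number.

## What is proved (`N` the numerator `log(τ₂/τ₁)`, `Δ > 0` the true abscissa `log(x₂/x₁)`, `D` the measured one, `|Δ − D| ≤ η`,
## `η < D`; `z = N/Δ`, `ẑ = N/D`)

* `abs_sub_sub_le_add` — `|(X₂ − X₁) − (x₂ − x₁)| ≤ η₁ + η₂` from `|Xᵢ − xᵢ| ≤ ηᵢ` (the abscissa error from the two scale errors).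
* **`div_mem_Icc_of_abscissa_error`** — for `N ≥ 0`: `N/(D + η) ≤ N/Δ ≤ N/(D − η)` (exact interval, both ends attained).
* **`abs_div_sub_div_le_of_abscissa_error`** — `|N/Δ − N/D| ≤ |N|·η / (D·(D − η))` (any sign of `N`).
* **`abs_exponent_sub_le_combined`** — THE COMBINED BUDGET with an ordinate error `|N − N̂| ≤ δ` as well:
  `|N/Δ − N̂/D| ≤ δ/(D − η) + |N̂|·η/(D·(D − η))` — the two error sources add, each amplified by the SHORT lever arm `D − η`.
In words (value-free): an uncertainty `η` in `log(x₂/x₁)` moves the exponent by the relative amount `η/(D − η)` at worst; with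
`D = log(x₂/x₁)` small (close spacings) the abscissa error is as dangerous as the ordinate error.  NOT CLAIMED: any value of
`a(β)`, its error, `τ_int` or `z`; correlations between the errors; that the published scale errors are bounds (they are `1σ`).
-/

namespace Summit.Ventures.LatticeQCDFlow.Scaling

/-- The abscissa error from the two scale errors: `|(X₂ − X₁) − (x₂ − x₁)| ≤ η₁ + η₂`. -/
theorem abs_sub_sub_le_add {X₁ X₂ x₁ x₂ η₁ η₂ : ℝ} (h₁ : |X₁ - x₁| ≤ η₁) (h₂ : |X₂ - x₂| ≤ η₂) :
    |(X₂ - X₁) - (x₂ - x₁)| ≤ η₁ + η₂ := by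
  have e : (X₂ - X₁) - (x₂ - x₁) = (X₂ - x₂) - (X₁ - x₁) := by ring
  rw [e]
  calc |(X₂ - x₂) - (X₁ - x₁)| ≤ |X₂ - x₂| + |X₁ - x₁| := abs_sub _ _
    _ ≤ η₂ + η₁ := add_le_add h₂ h₁
    _ = η₁ + η₂ := add_comm _ _

/-- Under `|Δ − D| ≤ η < D` the true abscissa is bracketed: `0 < D − η ≤ Δ ≤ D + η`. -/
theorem abscissa_bounds {Δ D η : ℝ} (h : |Δ - D| ≤ η) (hη : η < D) : 0 < D - η ∧ D - η ≤ Δ ∧ Δ ≤ D + η := by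
  obtain ⟨h1, h2⟩ := abs_le.1 h
  exact ⟨by linarith, by linarith, by linarith⟩

/-- **THE EXACT INTERVAL FOR ERRORS IN THE ABSCISSA** (`N ≥ 0`): `N/(D + η) ≤ N/Δ ≤ N/(D − η)`. -/
theorem div_mem_Icc_of_abscissa_error {N Δ D η : ℝ} (hN : 0 ≤ N) (h : |Δ - D| ≤ η) (hη : η < D) :
    N / (D + η) ≤ N / Δ ∧ N / Δ ≤ N / (D - η) := by
  obtain ⟨hpos, hlo, hhi⟩ := abscissa_bounds h hη
  have hΔ : 0 < Δ := lt_of_lt_of_le hpos hlo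
  exact ⟨div_le_div_of_nonneg_left hN hΔ hhi, div_le_div_of_nonneg_left hN hpos hlo⟩

/-- **`|N/Δ − N/D| ≤ |N|·η / (D·(D − η))`** for every sign of `N` (`|Δ − D| ≤ η < D`). -/
theorem abs_div_sub_div_le_of_abscissa_error {N Δ D η : ℝ} (h : |Δ - D| ≤ η) (hη : η < D) :
    |N / Δ - N / D| ≤ |N| * η / (D * (D - η)) := by
  obtain ⟨hpos, hlo, hhi⟩ := abscissa_bounds h hη
  have hΔ : 0 < Δ := lt_of_lt_of_le hpos hlo
  have hD : 0 < D := by linarith [(abs_nonneg (Δ - D)).trans h]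
  have hη0 : 0 ≤ η := (abs_nonneg _).trans h
  have e : N / Δ - N / D = N * (D - Δ) / (Δ * D) := by
    field_simp
  rw [e, abs_div, abs_mul, abs_of_pos (mul_pos hΔ hD)]
  have hnum : |N| * |D - Δ| ≤ |N| * η := by
    refine mul_le_mul_of_nonneg_left ?_ (abs_nonneg N)
    rw [abs_sub_comm]; exact h
  calc |N| * |D - Δ| / (Δ * D) ≤ |N| * η / (Δ * D) := div_le_div_of_nonneg_right hnum (mul_pos hΔ hD).le
    _ ≤ |N| * η / ((D - η) * D) := by
        refine div_le_div_of_nonneg_left (mul_nonneg (abs_nonneg N) hη0) (mul_pos hpos hD) ?_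
        exact mul_le_mul_of_nonneg_right hlo hD.le
    _ = |N| * η / (D * (D - η)) := by rw [mul_comm (D - η) D]

/-- **THE COMBINED BUDGET**: with an ordinate error `|N − N̂| ≤ δ` AND an abscissa error `|Δ − D| ≤ η < D`,
`|N/Δ − N̂/D| ≤ δ/(D − η) + |N̂|·η/(D·(D − η))`. -/
theorem abs_exponent_sub_le_combined {N Nh Δ D η δ : ℝ} (hN : |N - Nh| ≤ δ) (h : |Δ - D| ≤ η) (hη : η < D) :
    |N / Δ - Nh / D| ≤ δ / (D - η) + |Nh| * η / (D * (D - η)) := by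
  obtain ⟨hpos, hlo, _⟩ := abscissa_bounds h hη
  have hΔ : 0 < Δ := lt_of_lt_of_le hpos hlo
  have hδ0 : 0 ≤ δ := (abs_nonneg _).trans hN
  have split : N / Δ - Nh / D = (N - Nh) / Δ + (Nh / Δ - Nh / D) := by ring
  rw [split]
  refine (abs_add_le _ _).trans (add_le_add ?_ (abs_div_sub_div_le_of_abscissa_error h hη))
  rw [abs_div, abs_of_pos hΔ]
  calc |N - Nh| / Δ ≤ δ / Δ := div_le_div_of_nonneg_right hN hΔ.le
    _ ≤ δ / (D - η) := div_le_div_of_nonneg_left hδ0 hpos hlo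

end Summit.Ventures.LatticeQCDFlow.Scaling
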